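import Literature.Barriers.ValiantsHypothesis.BIJL18PermanentZero
import Literature.Computability.AlgebraicComplexity.KaltofenFactorPositiveChar
import HarnessLib

/-!
# Bläser–Ikenmeyer–Jindal–Lysikov 2018, Thm. 24 (Kaltofen's factor theorem over `𝔽_p`) — the
# named fact `BIJL2018_thm24` DISCHARGED

Theorem-only companion of `BIJL18PermanentZero.lean` (typed fact
`Literature.Barriers.ValiantsHypothesis.BIJL2018_thm24`: "If `f ∈ 𝔽_p[x₁, …, x_n]` can be computed
by an arithmetic circuit of size at most `s` and degree at most `d`, `f = Πᵢ gᵢ^{p^{eᵢ}·jᵢ}` …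
then we can compute … an arithmetic circuit for the factor `gᵢ^{p^{eᵢ}}` in randomized
`poly(n, s, d, log p)` time" — typed as the circuit-EXISTENCE content
`L(g^{p^e}) ≤ (n + L(f) + deg f + log₂ p + 2)^κ`). The proof is
`Literature.Computability.AlgebraicComplexity.KaltofenPosChar.kaltofenFactorBound_primeChar`
(`KaltofenFactorPositiveChar.lean`: Kaltofen 1986 §2 — symbolic shear and genericity polynomial
over `𝔽_p`, a good point in `GaloisField p k`, the linear Hensel lifting engine
`KaltofenHenselLifting.lean` on `f = (g^{p^e})^j · h`, a `j`-th root by Newton iteration, and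
descent to `𝔽_p` by simulating the extension field), with `κ = 80`. HONEST FRAMING: a 1986/1989
theorem of Kaltofen formalised (the randomised algorithm itself is not); `VP ≠ VNP` is NOT proved
and nothing here bears on it.

## References

* [BlaserIkenmeyerJindalLysikov2018] M. Bläser, C. Ikenmeyer, G. Jindal, V. Lysikov,
  *Generalized matrix completion and algebraic natural proofs*, STOC 2018 / ECCC TR18-064, Thm. 24.
* [Kaltofen1986] E. Kaltofen, *Uniform closure properties of P-computable functions*, STOC 1986,
  §2 (p. 334: the `p^ê`-th power replacement) and Thm. 2.1. [Kaltofen1989] (journal version).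
-/

namespace Literature.Barriers.ValiantsHypothesis

/-- **BIJL 2018 Thm. 24 (Kaltofen [Kal89] over `𝔽_p`), existence content — DISCHARGED.**
[cite: BlaserIkenmeyerJindalLysikov2018, Thm. 24; Kaltofen1986, §2 and Thm. 2.1] -/
theorem BIJL2018_thm24_holds : BIJL2018_thm24 :=
  Literature.Computability.AlgebraicComplexity.KaltofenPosChar.kaltofenFactorBound_primeChar

end Literature.Barriers.ValiantsHypothesis
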